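import Literature.AlgebraicGeometry.Resolution.CanonicalResolutionDatum
import Literature.AlgebraicGeometry.Resolution.EffectiveResolutionSpread
import HarnessLib

/-!
# BGMW Thm. 8.0.5 for `(𝔸ⁿ_k, (S), ∅, 1)` from characteristic zero: the reduction to a spreading-out step

Topic: `Literature/AlgebraicGeometry/Resolution`. Second line of attack on the named fact
`BierstoneGrigorievMilmanWlodarczyk2011_canonical` (`CanonicalResolution.lean`; its instances are
interderivable with the canonical resolution data `CanonicalResolutionDatum k n S` of
`CanonicalResolutionDatum.lean` — `CanonicalResolutionDatum.inner`, and
`CanonicalResolutionDatum.nonempty_iff_inner` in `CanonicalResolutionDatumProofs.lean`):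
Bierstone–Grigoriev–Milman–Włodarczyk, arXiv:1206.3090, Thm. 8.0.5 with Lemma 8.0.3 (1) and
Cor. 8.0.6–8.0.7 — a resolution of the marked ideal `(𝔸ⁿ_k, 𝓘_{V(S)}, ∅, 1)`, `|S| ≤ l`, degrees
`≤ d`, `k` perfect of characteristic `p > M(d, n, l)`, which over the regular locus of an integral
`Y = V(S)` is the blow-up of `Y` up to trivial steps.

BGMW obtain the positive-characteristic statement by re-running the characteristic-zero
algorithm (§4) under the multiplicity bound `M̄ < p` (§8, Thms. 8.0.4–8.0.5, with the §§5–7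
complexity recursion behind Lemma 8.0.3). This file records the OTHER classical route to "large
`p` depending only on `(d, n, l)`", exactly as `EffectiveResolutionSpread.lean` does for the
existence-only fact `BierstoneGrigorievMilmanWlodarczyk2011_marked`: the characteristic-ZERO
theorem (BGMW Thm. 4.0.6 = Włodarczyk 2005) at the generic points of residue characteristic
zero of the space `Spec ℤ[c]` of universal coefficients, a SPREADING-OUT step over a
neighbourhood of each such point, and the Noetherian induction of `LargeCharacteristic.lean`
(`exists_bound_forall_prime_of_generic`), which yields a (non-explicit) bound `M(d, n, l)`.

* `HasShapedResolution k n S` — the instance statement: the inner clause (i) ∧ (ii) of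
  `BierstoneGrigorievMilmanWlodarczyk2011_canonical` for ONE input `(k, n, S)` (a resolution `s`
  of `(𝔸ⁿ_k, 𝓘_{V(S)}, ∅, 1)` such that, if `V(S)` is integral, `s|U` extends the blow-up of
  `V(S) ∩ U` for every open `U` meeting `V(S)` inside its regular locus);
  `CanonicalResolutionDatum.hasShapedResolution` (a datum gives it, `CanonicalResolutionDatum.inner`);
  `hasShapedResolution_of_span_eq`, `hasShapedResolution_congr` — it only depends on the ideal
  `(S)` (transport along `V(S') ≅ V(S)` over `𝔸ⁿ_k`) — PROVED.
* (C0') `∀ K [CharZero K] n S, HasShapedResolution K n S` — the CHARACTERISTIC-ZERO INPUT: the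
  same inner statement for EVERY field of characteristic zero and every `S` (no bound), written
  OUT as the hypothesis `h0` of `canonical_of_charZero_of_spreads` (it is NOT a declaration of the
  tree; D-0026 review 2026-08-15: the former pass-through named fact
  `BierstoneGrigorievMilmanWlodarczyk2011_canonicalCharZero` naming (C0') was merged back into that
  hypothesis and into the implication `canonicalCharZero_of_kollarThms` of
  `CanonicalResolutionKollar.lean`, which PROVES (C0') from the two pre-existing Kollár leaves
  `Kollar2007Thm3_103`, `Kollar2007Thm3_107` — Kollár 2007, Thms. 3.103, 3.107, the two inductive
  steps 3.70 of Thms. 3.68–3.69 with their functoriality package 3.34 — exactly as (C0) was merged in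
  `EffectiveResolutionSpread.lean`). As a statement (C0') is BGMW Thm. 4.0.6 (canonical
  resolution of marked ideals in characteristic zero: existence, with its functoriality (2) for
  the open immersions into the smooth region and the value of the canonical resolution on a
  smooth centre) for the marked ideals `(𝔸ⁿ_K, 𝓘_{V(S)}, ∅, 1)`, carried from algebraically
  closed fields to all fields of characteristic zero by the Galois-descent Remark (p. 23;
  Włodarczyk 2005 §5.4). Printed (p. 11): "Theorem 4.0.6. There is an associated resolution
  `(X_i)_{0 ≤ i ≤ m_X}`, called canonical, satisfying the following conditions: (1) For any
  surjective étale morphism `φ : X' → X` the induced sequence `(X'_i) = φ^*(X_i)` is the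
  canonical resolution of `(X', 𝓘', E', μ) := φ^*(X, 𝓘, E, μ)`. (2) For any étale mophism
  `φ : M' → M` the induced sequence `(X'_i) = φ^*(X_i)` is an extension of the canonical
  resolution of `(X', 𝓘', E', μ) := φ^*(X, 𝓘, E, μ)`" (resolution = Def. 3.1.3, extension =
  Def. 3.1.5; ground field algebraically closed of characteristic zero, §3); the value on
  `(U, 𝓘_Z, ∅, 1)` for a smooth closed `Z ⊂ U` is the single blow-up of `Z` (proof of Thm. 4.0.6,
  pp. 11–13: `𝒥 = 𝒞(ℋ(𝓘_Z, 1)) = (𝓘_Z, 1)`, Step 1a void, Step 1b down the hypersurfaces of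
  maximal contact through `Z` to `Z` itself, where the restricted ideal is `0` and "the blow-up
  of `X` is the empty set and thus it defines a unique resolution", the local centres gluing to
  `Z`; then `𝓘₁ = 𝒪`; Włodarczyk 2005 Thm. 1.0.2 (b), §5.6), and the case `(S) = 0` is that same
  first line of the proof. In the tree's vocabulary (C0') is WEAKER than printed ((1), the rest
  of (2), general `(X, 𝓘, E, μ)` dropped) and regular = smooth in characteristic zero.
* `SpreadsShapedFromGenericPoint n d l` — the SPREADING-OUT STEP (a `Prop`, NOT a named fact and
  not yet proved; classical technique of EGA IV₃ §§8–9, IV₄ §17): if the universal instance over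
  the fraction field `K` of `ℤ[c]/𝔮` (`𝔮` a prime of residue characteristic zero) has a shaped
  resolution, then so does the instance at every perfect-field-valued point of a neighbourhood
  `D(f) ∩ V(𝔮)`. (Why it is true: spread the centres to smooth families over `(ℤ[c]/𝔮)_f`;
  blow-ups of smooth centres in smooth families commute with base change; if `(S)_K` is prime the
  finitely many conditions "centre empty over `𝔸ⁿ ∖ Sing`" / "centre = `𝓘_Y` over `𝔸ⁿ ∖ Sing`"
  spread with the smooth locus of `Y/B`, which specializes to `Reg` over perfect fields; if
  `(S)_K` is not prime, witnesses `g ∉ (S), gʳ ∈ (S)` or `gh ∈ (S), g, h ∉ (S)` spread by generic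
  flatness, so no nearby fibre is integral and clause (ii) is vacuous there.)
* `canonical_of_charZero_of_spreads :
    (∀ K [CharZero K] n S, HasShapedResolution K n S) → (∀ n d l, SpreadsShapedFromGenericPoint n d l)
      → BierstoneGrigorievMilmanWlodarczyk2011_canonical` — PROVED (Noetherian induction on
  `Spec ℤ[c]`, goodness of `𝔭` = "every instance at a perfect-field-valued point with kernel `𝔭`
  has a shaped resolution").

So on this line the large-characteristic named fact rests on (C0') (the algorithm of §4, shared
with the characteristic-zero resolution programme of the tree: PROVED from `Kollar2007Thm3_103`
and `Kollar2007Thm3_107` in `CanonicalResolutionKollar.lean`, `canonical_of_kollarThms_of_spreads`)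
and on `SpreadsShapedFromGenericPoint`.

## Sources

* E. Bierstone, D. Grigoriev, P. Milman, J. Włodarczyk, *Effective Hironaka resolution and its
  complexity (with appendix on applications in positive characteristic)*, arXiv:1206.3090 (arXiv
  numbering): Defs. 3.1.3–3.1.5 (p. 6), Thm. 4.0.6 and its proof (pp. 11–13), §8: Lemma 8.0.3,
  Thms. 8.0.4–8.0.5, Remark, Cor. 8.0.6–8.0.7 (p. 23). [BierstoneGrigorievMilmanWlodarczyk2011]
* J. Włodarczyk, *Simple Hironaka resolution in characteristic zero*, J. Amer. Math. Soc. 18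
  (2005) 779–822: Thm. 1.0.2 (b), §5.4, §5.6. [Wlodarczyk2005]
-/

noncomputable section

open CategoryTheory CategoryTheory.Limits AlgebraicGeometry TopologicalSpace Topology MvPolynomial

namespace Literature.AlgebraicGeometry.Resolution

/-! ## The instance statement and its invariance under change of generators -/

/-- **`(𝔸ⁿ_k, (S), ∅, 1)` has a resolution of canonical shape over the regular locus**: the
inner clause (i) ∧ (ii) of `BierstoneGrigorievMilmanWlodarczyk2011_canonical` for one input
`(k, n, S)` — a multiple blow-up `s` of `𝔸ⁿ_k` resolving the marked ideal `(𝔸ⁿ_k, 𝓘_{V(S)}, ∅, 1)`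
(BGMW Def. 3.1.3) such that, if `Y = V(S)` is integral, for every open immersion `j : U → 𝔸ⁿ_k`
meeting `Y` and meeting it inside its regular locus, `s|U` is an extension (Def. 3.1.5) of the
one-step sequence blowing up `𝓘_Y|U`.
[cite: BierstoneGrigorievMilmanWlodarczyk2011, Thm. 8.0.5 (existence, (2)) with Def. 3.1.5 and proof of Thm. 4.0.6] -/
def HasShapedResolution (k : Type) [Field k] (n : ℕ) (S : Finset (MvPolynomial (Fin n) k)) :
    Prop :=
  ∃ s : CentreSeq (Spec (CommRingCat.of (MvPolynomial (Fin n) k))),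
    s.IsResolutionOf ⟨(affineZeroLocusι k n S).ker, [], 1⟩ ∧
    (IsIntegral (affineZeroLocus k n S) →
      ∀ (U : Scheme.{0}) (j : U ⟶ Spec (CommRingCat.of (MvPolynomial (Fin n) k)))
        [IsOpenImmersion j],
        (∃ y : affineZeroLocus k n S, affineZeroLocusι k n S y ∈ Set.range j) →
        (∀ y : affineZeroLocus k n S, affineZeroLocusι k n S y ∈ Set.range j →
          IsRegularLocalRing ((affineZeroLocus k n S).presheaf.stalk y)) →
          (s.restrict j).IsExtensionOfSingle ((affineZeroLocusι k n S).ker.comap j))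

/-- A canonical resolution datum yields a shaped resolution (`CanonicalResolutionDatum.inner`).
[cite: BierstoneGrigorievMilmanWlodarczyk2011, Thm. 8.0.5 with Cor. 8.0.6–8.0.7] -/
theorem CanonicalResolutionDatum.hasShapedResolution {k : Type} [Field k] {n : ℕ}
    {S : Finset (MvPolynomial (Fin n) k)} (D : CanonicalResolutionDatum k n S) :
    HasShapedResolution k n S :=
  D.inner

/-- The closed immersions `V(S') ↪ 𝔸ⁿ_k` and `V(S) ↪ 𝔸ⁿ_k` differ by the isomorphism
`V(S') ≅ V(S)` induced by `k[x]⧸(S) ≃ k[x]⧸(S')` when `(S) = (S')`. [folklore] -/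
theorem affineZeroLocusι_eq_comp_of_span_eq (k : Type) [Field k] (n : ℕ)
    {S S' : Finset (MvPolynomial (Fin n) k)}
    (h : Ideal.span (S : Set (MvPolynomial (Fin n) k)) = Ideal.span (S' : Set _)) :
    affineZeroLocusι k n S' =
      (Spec.map (Ideal.quotEquivOfEq h).toCommRingCatIso.hom :
        affineZeroLocus k n S' ⟶ affineZeroLocus k n S) ≫ affineZeroLocusι k n S := by
  have hfac : CommRingCat.ofHom (Ideal.Quotient.mk (Ideal.span (S' : Set (MvPolynomial (Fin n) k)))) =
      CommRingCat.ofHom (Ideal.Quotient.mk (Ideal.span (S : Set (MvPolynomial (Fin n) k)))) ≫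
        (Ideal.quotEquivOfEq h).toCommRingCatIso.hom := by
    change _ = CommRingCat.ofHom _ ≫ CommRingCat.ofHom (Ideal.quotEquivOfEq h).toRingHom
    rw [← CommRingCat.ofHom_comp]
    congr 1
  delta affineZeroLocusι
  rw [hfac, Spec.map_comp]

/-- **`HasShapedResolution` only depends on the ideal `(S)`** (one direction): transport of the
resolution clause along `𝓘_{V(S)} = 𝓘_{V(S')}` and of the shape clause along the isomorphism
`V(S') ≅ V(S)` over `𝔸ⁿ_k` (integrality, the points met by `U`, regularity of the stalks).
[folklore] -/
theorem hasShapedResolution_of_span_eq (k : Type) [Field k] (n : ℕ)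
    {S S' : Finset (MvPolynomial (Fin n) k)}
    (h : Ideal.span (S : Set (MvPolynomial (Fin n) k)) = Ideal.span (S' : Set _)) :
    HasShapedResolution k n S → HasShapedResolution k n S' := by
  rintro ⟨s, hs, hii⟩
  -- the comparison isomorphism `ε : V(S') ⟶ V(S)` over `𝔸ⁿ_k`
  set ε : affineZeroLocus k n S' ⟶ affineZeroLocus k n S :=
    Spec.map (Ideal.quotEquivOfEq h).toCommRingCatIso.hom with hε
  haveI hεiso : IsIso ε :=
    (inferInstance : IsIso (Spec.map (Ideal.quotEquivOfEq h).toCommRingCatIso.hom))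
  have hι : affineZeroLocusι k n S' = ε ≫ affineZeroLocusι k n S :=
    affineZeroLocusι_eq_comp_of_span_eq k n h
  have hker : (affineZeroLocusι k n S').ker = (affineZeroLocusι k n S).ker :=
    (ker_affineZeroLocusι_eq_of_span_eq k n h).symm
  refine ⟨s, by rw [hker]; exact hs, fun hint' U j _ hmeet' hreg' => ?_⟩
  -- integrality, the meeting point and the regularity hypothesis transported to `V(S)`
  haveI := hint'
  have hint : IsIntegral (affineZeroLocus k n S) := IsIntegral.of_isIso ε
  have hmeet : ∃ y : affineZeroLocus k n S, affineZeroLocusι k n S y ∈ Set.range j := by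
    obtain ⟨y', hy'⟩ := hmeet'
    refine ⟨ε y', ?_⟩
    rw [hι, Scheme.Hom.comp_apply] at hy'
    exact hy'
  have hreg : ∀ y : affineZeroLocus k n S, affineZeroLocusι k n S y ∈ Set.range j →
      IsRegularLocalRing ((affineZeroLocus k n S).presheaf.stalk y) := by
    intro y hy
    have hy' : ε (inv ε y) = y := by
      rw [← Scheme.Hom.comp_apply, IsIso.inv_hom_id]
      rfl
    have hreg'' : IsRegularLocalRing ((affineZeroLocus k n S').presheaf.stalk (inv ε y)) := by
      refine hreg' (inv ε y) ?_
      rw [hι, Scheme.Hom.comp_apply, hy']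
      exact hy
    rw [← hy']
    haveI := hreg''
    exact IsRegularLocalRing.of_ringEquiv (asIso (ε.stalkMap (inv ε y))).commRingCatIsoToRingEquiv.symm
  have h2 := hii hint U j hmeet hreg
  rwa [← hker] at h2

/-- **`HasShapedResolution` only depends on the ideal `(S)`.** [folklore] -/
theorem hasShapedResolution_congr (k : Type) [Field k] (n : ℕ)
    {S S' : Finset (MvPolynomial (Fin n) k)}
    (h : Ideal.span (S : Set (MvPolynomial (Fin n) k)) = Ideal.span (S' : Set _)) :
    HasShapedResolution k n S ↔ HasShapedResolution k n S' :=
  ⟨hasShapedResolution_of_span_eq k n h, hasShapedResolution_of_span_eq k n h.symm⟩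

/-! ## The spreading-out step and the reduction -/

/-- (SP) **The spreading-out step for shaped resolutions** of the universal family of `l`
polynomials of exponents `≤ d` in `n` variables (a `Prop`; classical EGA IV₃ §§8–9 / IV₄ §17
technique — NOT a named fact and not yet proved in the tree): for every prime `𝔮 ⊆ ℤ[c]`
containing no prime number, if the universal instance over the fraction field of `ℤ[c]/𝔮` has a
shaped resolution, then there is `f ∉ 𝔮` such that the instance at every PERFECT-field-valued
point `φ : ℤ[c] → k` with `𝔮 ⊆ ker φ`, `φ(f) ≠ 0` has a shaped resolution. (Spread the centres to
smooth families over `(ℤ[c]/𝔮)_f`, where blow-ups of smooth centres commute with base change and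
controlled transforms, snc and the emptiness of the final support specialize; if `(S)` is prime
over the fraction field, the shape conditions over `𝔸ⁿ ∖ Sing(Y/B)` are finitely many
equalities/emptinesses of ideal sheaves and spread too, the smooth locus of `Y/B` specializing
to the regular locus over a perfect field; if `(S)` is not prime over the fraction field,
witnesses of non-primality spread by generic flatness and clause (ii) is vacuous nearby.)
[folklore] -/
def SpreadsShapedFromGenericPoint (n d l : ℕ) : Prop :=
  ∀ (𝔮 : Ideal (CoeffRing n d l)) [𝔮.IsPrime], (∀ p : ℕ, p.Prime → (p : CoeffRing n d l) ∉ 𝔮) →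
    HasShapedResolution (FractionRing (CoeffRing n d l ⧸ 𝔮)) n
      (univFamily n d l (algebraMap (CoeffRing n d l) (FractionRing (CoeffRing n d l ⧸ 𝔮)))) →
    ∃ f ∉ 𝔮, ∀ (k : Type) [Field k] [PerfectField k] (φ : CoeffRing n d l →+* k),
      𝔮 ≤ RingHom.ker φ → φ f ≠ 0 → HasShapedResolution k n (univFamily n d l φ)

/-- **`BierstoneGrigorievMilmanWlodarczyk2011_canonical` from (C0') — shaped resolutions of
`(𝔸ⁿ_K, 𝓘_{V(S)}, ∅, 1)` over every field of characteristic zero (BGMW Thm. 4.0.6, existence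
and (2); the hypothesis `h0`, written out, see the module docstring; supplied from Kollár's
Thms. 3.103, 3.107 by `canonicalCharZero_of_kollarThms`, `CanonicalResolutionKollar.lean`) — and
the spreading-out step**, with a non-explicit bound `M(d, n, l)`: Noetherian induction on
`Spec ℤ[c]` (`exists_bound_forall_prime_of_generic`), the goodness of a prime `𝔭` being "every
instance at a perfect-field-valued point with kernel `𝔭` has a shaped resolution"; at a prime of
residue characteristic zero the universal instance over the fraction field is resolved by
(C0') and spread by (SP); an input `S` over a perfect field `k` of
characteristic `p > M(d, n, l)` is, up to the ideal it generates (`span_univFamily_coeffHom`,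
`hasShapedResolution_congr`), the specialization at a point whose kernel contains no prime
number `≤ M`. [cite: BierstoneGrigorievMilmanWlodarczyk2011, Thm. 8.0.5 with Cor. 8.0.6–8.0.7; Thm. 4.0.6 (existence, (2)) for `h0`] -/
theorem canonical_of_charZero_of_spreads
    (h0 : ∀ (K : Type) [Field K] [CharZero K] (n : ℕ) (S : Finset (MvPolynomial (Fin n) K)),
      HasShapedResolution K n S)
    (hSP : ∀ n d l : ℕ, SpreadsShapedFromGenericPoint n d l) :
    BierstoneGrigorievMilmanWlodarczyk2011_canonical := by
  classical
  -- the good primes of `ℤ[c]`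
  let Good : ∀ n d l : ℕ, Ideal (CoeffRing n d l) → Prop := fun n d l 𝔭 =>
    ∀ (k : Type) [Field k] [PerfectField k] (φ : CoeffRing n d l →+* k), RingHom.ker φ = 𝔭 →
      HasShapedResolution k n (univFamily n d l φ)
  have hbound : ∀ n d l : ℕ, ∃ M : ℕ, ∀ 𝔭 : Ideal (CoeffRing n d l), 𝔭.IsPrime →
      (∀ p : ℕ, p.Prime → (p : CoeffRing n d l) ∈ 𝔭 → M < p) → Good n d l 𝔭 := by
    intro n d l
    refine exists_bound_forall_prime_of_generic (Good n d l) fun 𝔮 h𝔮 hchar => ?_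
    haveI := h𝔮
    haveI := charZero_fractionRing_quotient 𝔮 hchar
    obtain ⟨f, hf𝔮, hf⟩ := hSP n d l 𝔮 hchar (h0 _ n _)
    exact ⟨f, hf𝔮, fun 𝔭 _ hle hf𝔭 k _ _ φ hker =>
      hf k φ (hker ▸ hle) (fun h => hf𝔭 (hker ▸ (RingHom.mem_ker).mpr h))⟩
  choose M hM using hbound
  refine ⟨fun d n l => M n d l, fun p hp k _ _ _ n d l S hS hd hMp => ?_⟩
  -- the input `S` is the specialization at `coeffHom S`, a point of characteristic `p > M`
  have hgood : Good n d l (RingHom.ker (coeffHom (d := d) (l := l) S)) :=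
    hM n d l _ (RingHom.ker_isPrime _) fun q hq hqk => lt_of_prime_mem_ker_coeffHom S hMp hq hqk
  have hres : HasShapedResolution k n (univFamily n d l (coeffHom S)) := hgood k (coeffHom S) rfl
  exact (hasShapedResolution_congr k n (span_univFamily_coeffHom S hS hd)).mp hres

end Literature.AlgebraicGeometry.Resolution

end
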